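import Summits.ABC.IUTFork.Thm311RealIsmDHMover
import HarnessLib

/-!
# [IUTchIII] Cor. 3.12, TEAM R `indFixes` thread: the PARITY law of the ramified mover — which multiples of the
# log-shell the Dupuy–Hilado (Ind2) element of `Thm311RealIsmDHMover` fixes and which it moves

PROOF-ONLY sequel (0 definitions, 0 named facts) of `Thm311RealIsmDHMover` (p421508; abc-iut cell, WAVE-5 seat
abc-iut-w5-d216 gen 2, TEAM R support); TAKES NO SIDE on [IUTchIII] Cor. 3.12.  p421508 produced, at every
tame quadratically ramified place `v` (`p_v ≥ 5`, `e = 2`, `f = 1`), ONE element `φ ∈ Real.ismDH (analyticLogv F)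
(.inr v)` and ONE moved multiple `c • I_v` (`c` a uniformizer).  For the composition with R1's negative horn
`Cor312.Setting.not_identifiedReading_identify_ofComparison_of_moves` at an assembled real setting (w5-d068's
audit note I1 on p421508; this seat's wiring note 04:45Z, step (4)) one needs the full PARITY LAW of that
element: which `𝒪_v`-balls it fixes and which it moves.  This file proves it:

* `IsmDHMover.exists_swap_parity` — the `ℤ_p`-basis swap of p421508 (generic normed `ℚ_p`-algebra of
  dimension `2` with `‖ϖ‖² = p⁻¹`) maps the closed ball `B(0, ‖ϖ‖^{2k−1})` ONTO itself for EVERY `k ∈ ℤ` and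
  moves `B(0, ‖ϖ‖^{2k})` for EVERY `k ∈ ℤ` (the element `p^k·1` of the latter is sent to `p^{k−1}·ϖ`, of norm
  `‖ϖ‖^{2k−1} > ‖ϖ‖^{2k}`): the swap stabilises exactly the balls whose `ϖ`-order has the parity of the
  log-shell's (`I_v = B(0, ‖ϖ‖⁻¹)`, order `−1`);
* `exists_ismDH_parity` — at the number-field carriers: a uniformizer `c` of `K_v` and ONE
  `φ ∈ Real.ismDH (analyticLogv F) (.inr v)` with `φ '' (c^{2n} • I_v) = c^{2n} • I_v` and
  `φ '' (c^{2n+1} • I_v) ≠ c^{2n+1} • I_v` for every `n : ℕ` (even powers = the congruence case of R1's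
  `ismDH_image_smul_shell` up to units; odd powers = the movers).

Classical (Serre, *Local Fields* II; Dupuy–Hilado §4.9 «`ℤ_p`-lattice isomorphisms of `I_v`»); consumed BY NAME:
p421508's bookkeeping lemmas, abc-iut-S7 `RescaledCompletion`, abc-iut-S1 `prop12iEq_holds` (through p421508).
[cite: DupuyHilado2025, §4.9] [cite: NeukirchANT1999, Ch. II Prop. (5.5)] [claim: Mochizuki2012, status: disputed]
for every [IUTchIII] locution.  Nothing here decides which reading of (Ind2) is print's.
-/

noncomputable section

open Metric Set
open scoped Pointwise

namespace Summit.ABC.IUTFork.Thm311.Real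

open Literature.IUT.LogVolume Literature.NumberTheory.NumberFields
open Literature.NumberTheory.GaloisRepresentations.Ultrametric
open NumberField IsDedekindDomain

namespace IsmDHMover

variable {p : ℕ} [Fact p.Prime] {K : Type*} [NontriviallyNormedField K] [NormedAlgebra ℚ_[p] K]

/-- **The parity law of the swap.** Over an ultrametric normed `ℚ_p`-algebra `K` of dimension `2` with
`‖ϖ‖² = p⁻¹` there is a `ℚ_p`-linear automorphism `φ` (the `ℤ_p`-basis swap `a·1 + b·ϖ ↦ p·b·1 + p⁻¹·a·ϖ` of
p421508), continuous with continuous inverse, with `φ 1 = p⁻¹ • ϖ`, mapping `B(0, ‖ϖ‖^{2k−1})` ONTO itself and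
MOVING `B(0, ‖ϖ‖^{2k})`, for every `k ∈ ℤ`. [cite: DupuyHilado2025, §4.9] -/
theorem exists_swap_parity [IsUltrametricDist K] {ϖ : K} (hsq : ‖ϖ‖ ^ 2 = (p : ℝ)⁻¹)
    (hfin : Module.finrank ℚ_[p] K = 2) :
    ∃ φ : K ≃ₗ[ℚ_[p]] K, Continuous φ ∧ Continuous φ.symm ∧ φ 1 = (p : ℚ_[p])⁻¹ • ϖ ∧
      (∀ k : ℤ, ⇑φ '' closedBall (0 : K) (‖ϖ‖ ^ (2 * k - 1)) = closedBall (0 : K) (‖ϖ‖ ^ (2 * k - 1))) ∧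
      ∀ k : ℤ, ⇑φ '' closedBall (0 : K) (‖ϖ‖ ^ (2 * k)) ≠ closedBall (0 : K) (‖ϖ‖ ^ (2 * k)) := by
  obtain ⟨h0, h1⟩ := norm_pos_and_lt_one hsq
  have hϖ0 : ϖ ≠ 0 := norm_pos_iff.mp h0
  have hp0 : (p : ℚ_[p]) ≠ 0 := Nat.cast_ne_zero.mpr (Fact.out : p.Prime).ne_zero
  haveI : FiniteDimensional ℚ_[p] K := Module.finite_of_finrank_eq_succ hfin
  -- the basis `{1, ϖ}` and the swap, as in p421508
  have hcard : Fintype.card (Fin 2) = Module.finrank ℚ_[p] K := by rw [hfin, Fintype.card_fin]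
  let bs : Module.Basis (Fin 2) ℚ_[p] K :=
    basisOfLinearIndependentOfCardEqFinrank (linearIndependent_one_varpi hsq) hcard
  have hbs : ⇑bs = ![(1 : K), ϖ] := coe_basisOfLinearIndependentOfCardEqFinrank _ _
  have hb0 : bs 0 = 1 := by rw [hbs]; rfl
  have hb1 : bs 1 = ϖ := by rw [hbs]; rfl
  have hdecomp : ∀ x : K, x = (bs.repr x 0) • (1 : K) + (bs.repr x 1) • ϖ := fun x => by
    conv_lhs => rw [← bs.sum_repr x]
    rw [Fin.sum_univ_two, hb0, hb1]
  let f : K →ₗ[ℚ_[p]] K :=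
    (((p : ℚ_[p]) • bs.coord 1).smulRight (1 : K)) + ((((p : ℚ_[p])⁻¹) • bs.coord 0).smulRight ϖ)
  have hf : ∀ x : K, f x = ((p : ℚ_[p]) * bs.repr x 1) • (1 : K) + ((p : ℚ_[p])⁻¹ * bs.repr x 0) • ϖ :=
    fun x => rfl
  have hf0 : f (bs 0) = (p : ℚ_[p])⁻¹ • ϖ := by
    rw [hf, bs.repr_self]
    simp
  have hf1 : f (bs 1) = (p : ℚ_[p]) • (1 : K) := by
    rw [hf, bs.repr_self]
    simp
  have hff : f.comp f = LinearMap.id := by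
    refine bs.ext fun i => ?_
    fin_cases i
    · show f (f (bs 0)) = bs 0
      rw [hf0, map_smul, ← hb1, hf1, smul_smul, inv_mul_cancel₀ hp0, one_smul, hb0]
    · show f (f (bs 1)) = bs 1
      rw [hf1, map_smul, ← hb0, hf0, smul_smul, mul_inv_cancel₀ hp0, one_smul, hb1]
  have hinv : Function.Involutive f := fun x => by
    have := LinearMap.congr_fun hff x
    simpa using this
  let φ : K ≃ₗ[ℚ_[p]] K := LinearEquiv.ofInvolutive f hinv
  have hφ : ∀ x, φ x = f x := fun x => rfl
  have hnp : ‖(p : ℚ_[p])‖ = ‖ϖ‖ ^ 2 := by rw [Padic.norm_p, hsq]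
  have hnp' : ‖(p : ℚ_[p])⁻¹‖ = ‖ϖ‖ ^ (-2 : ℤ) := by
    rw [norm_inv, hnp, zpow_neg, zpow_ofNat]
  -- `f` maps `B(0, ‖ϖ‖^{2k-1})` into itself
  have hS : ∀ (k : ℤ) (x : K), ‖x‖ ≤ ‖ϖ‖ ^ (2 * k - 1) → ‖f x‖ ≤ ‖ϖ‖ ^ (2 * k - 1) := by
    intro k x hx
    rw [hdecomp x, norm_combo hsq] at hx
    rw [hf, norm_combo hsq, norm_mul, norm_mul, hnp', hnp]
    obtain ⟨ha, hb⟩ := max_le_iff.mp hx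
    -- `‖a‖ ≤ ‖ϖ‖^{2k}` and `‖b‖ ≤ ‖ϖ‖^{2k-2}`
    have ha' : ‖bs.repr x 0‖ ≤ ‖ϖ‖ ^ (2 * k) := (norm_padic_le_zpow_iff hsq _ _).mp ha
    have hb' : ‖bs.repr x 1‖ ≤ ‖ϖ‖ ^ (2 * (k - 1)) := by
      have : ‖bs.repr x 1‖ ≤ ‖ϖ‖ ^ (2 * k - 1) / ‖ϖ‖ := (le_div_iff₀ h0).mpr hb
      rw [show ‖ϖ‖ ^ (2 * k - 1) / ‖ϖ‖ = ‖ϖ‖ ^ (2 * (k - 1)) by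
        rw [div_eq_iff h0.ne', ← zpow_add_one₀ h0.ne']; congr 1; ring] at this
      exact this
    refine max_le ?_ ?_
    · -- `‖ϖ‖² · ‖b‖ ≤ ‖ϖ‖^{2k-1}`
      have hb'' : ‖bs.repr x 1‖ ≤ ‖ϖ‖ ^ (2 * (k - 1) - 1) := (norm_padic_le_zpow_iff hsq _ _).mpr hb'
      calc ‖ϖ‖ ^ 2 * ‖bs.repr x 1‖ ≤ ‖ϖ‖ ^ 2 * ‖ϖ‖ ^ (2 * (k - 1) - 1) := by gcongr
        _ = ‖ϖ‖ ^ (2 * k - 1) := by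
          rw [← zpow_natCast ‖ϖ‖ 2, ← zpow_add₀ h0.ne']; congr 1; push_cast; ring
    · -- `‖ϖ‖⁻² · ‖a‖ · ‖ϖ‖ ≤ ‖ϖ‖^{2k-1}`
      calc ‖ϖ‖ ^ (-2 : ℤ) * ‖bs.repr x 0‖ * ‖ϖ‖ ≤ ‖ϖ‖ ^ (-2 : ℤ) * ‖ϖ‖ ^ (2 * k) * ‖ϖ‖ := by gcongr
        _ = ‖ϖ‖ ^ (2 * k - 1) := by
          rw [← zpow_add₀ h0.ne', ← zpow_add_one₀ h0.ne']; congr 1; ring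
  have himg : ∀ k : ℤ, ⇑φ '' closedBall (0 : K) (‖ϖ‖ ^ (2 * k - 1)) = closedBall (0 : K) (‖ϖ‖ ^ (2 * k - 1)) := by
    intro k
    refine Set.Subset.antisymm ?_ ?_
    · rintro _ ⟨x, hx, rfl⟩
      rw [mem_closedBall_zero_iff] at hx ⊢
      rw [hφ]
      exact hS k x hx
    · intro x hx
      rw [mem_closedBall_zero_iff] at hx
      refine ⟨φ x, ?_, ?_⟩
      · rw [mem_closedBall_zero_iff, hφ]; exact hS k x hx
      · rw [hφ, hφ]; exact hinv x
  -- `p^k · 1 ∈ B(0, ‖ϖ‖^{2k})` is sent to `p^{k-1} · ϖ`, of norm `‖ϖ‖^{2k-1} > ‖ϖ‖^{2k}`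
  have hφ1 : φ 1 = (p : ℚ_[p])⁻¹ • ϖ := by rw [hφ, ← hb0, hf0]
  have hmove : ∀ k : ℤ, ⇑φ '' closedBall (0 : K) (‖ϖ‖ ^ (2 * k)) ≠ closedBall (0 : K) (‖ϖ‖ ^ (2 * k)) := by
    intro k h
    have hxk : ((p : ℚ_[p]) ^ k) • (1 : K) ∈ closedBall (0 : K) (‖ϖ‖ ^ (2 * k)) := by
      rw [mem_closedBall_zero_iff, norm_smul, norm_one, mul_one, norm_zpow, hnp, ← zpow_natCast, ← zpow_mul]
      norm_num
    have hmem : φ (((p : ℚ_[p]) ^ k) • (1 : K)) ∈ closedBall (0 : K) (‖ϖ‖ ^ (2 * k)) := by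
      rw [← h]; exact ⟨_, hxk, rfl⟩
    rw [map_smul, hφ1, smul_smul, mem_closedBall_zero_iff, norm_smul, norm_mul, norm_zpow, hnp, norm_inv, hnp,
      ← zpow_natCast, ← zpow_mul, ← zpow_neg, ← zpow_add₀ h0.ne', ← zpow_add_one₀ h0.ne',
      zpow_le_zpow_iff_right_of_lt_one₀ h0 h1] at hmem
    norm_num at hmem
    omega
  exact ⟨φ, LinearMap.continuous_of_finiteDimensional (φ : K →ₗ[ℚ_[p]] K),
    LinearMap.continuous_of_finiteDimensional (φ.symm : K →ₗ[ℚ_[p]] K), hφ1, himg, hmove⟩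

end IsmDHMover

/-! ## At the number-field carriers: even powers of a uniformizer are fixed, odd powers are moved -/

section Instance

variable {F : Type} [Field F] [NumberField F] (p : ℕ) [Fact p.Prime] (v : HeightOneSpectrum (𝓞 F))

/-- **PARITY at a tame quadratically ramified place.** For a number field `F`, a finite place `v` with
residue characteristic `p ≥ 5`, `e(v|p) = 2`, `f(v|p) = 1`: there are a uniformizer `c` of `K_v` (`c ≠ 0`,
`‖c‖ < 1`) and ONE `φ ∈ Real.ismDH (analyticLogv F) (.inr v)` — a bicontinuous `ℚ`-linear automorphism of `K_v`
fixing the analytic log-shell `I_v` — with `φ '' (c^{2n} • I_v) = c^{2n} • I_v` and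
`φ '' (c^{2n+1} • I_v) ≠ c^{2n+1} • I_v` for every `n : ℕ` (the swap fixes exactly the `𝒪_v`-balls whose
`π`-order has the parity of the log-shell's). [cite: DupuyHilado2025, §4.9] -/
theorem exists_ismDH_parity (hp : residueChar F v = p) (h5 : 5 ≤ p)
    (he : v.asIdeal.ramificationIdx ℤ = 2) (hf : v.asIdeal.inertiaDeg ℤ = 1) :
    ∃ c : Carrier (.inr v : Place F), c ≠ 0 ∧ ‖c‖ < 1 ∧
      ∃ φ ∈ ismDH (analyticLogv F) (.inr v : Place F),
        (∀ n : ℕ, ⇑φ '' (c ^ (2 * n) • shell (analyticLogv F) (.inr v : Place F)) =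
          c ^ (2 * n) • shell (analyticLogv F) (.inr v : Place F)) ∧
        ∀ n : ℕ, ⇑φ '' (c ^ (2 * n + 1) • shell (analyticLogv F) (.inr v : Place F)) ≠
          c ^ (2 * n + 1) • shell (analyticLogv F) (.inr v : Place F) := by
  have hv : ((p : ℕ) : 𝓞 F) ∈ v.asIdeal := hp ▸ natCast_residueChar_mem F v
  obtain ⟨hfin, ϖ, hϖ, hsq⟩ := exists_uniformizer_sq p v hv he hf
  set K := RescaledCompletion F p v hv with hK
  let e : Carrier (.inr v : Place F) ≃+* K := RescaledCompletion.of F p v hv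
  obtain ⟨h0, h1⟩ := IsmDHMover.norm_pos_and_lt_one hsq
  obtain ⟨φ, hφc, hφc', -, hfix, hmov⟩ := IsmDHMover.exists_swap_parity (K := K) hsq hfin
  have hshell : shell (analyticLogv F) (.inr v) = e.symm '' closedBall (0 : K) ‖(ϖ : K)‖⁻¹ :=
    shell_analyticLogv_eq_image_closedBall p v hv hp h5 he hϖ
  -- powers of `ϖ` scale the ball: `ϖ^m • B(0, ‖ϖ‖⁻¹) = B(0, ‖ϖ‖^{m-1})`
  have hpow : ∀ m : ℕ, (ϖ : K) ^ m • closedBall (0 : K) ‖(ϖ : K)‖⁻¹ = closedBall (0 : K) (‖(ϖ : K)‖ ^ ((m : ℤ) - 1)) := by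
    intro m
    rw [smul_closedBall _ _ (inv_nonneg.mpr (norm_nonneg _)), smul_zero, norm_pow, ← zpow_natCast,
      ← zpow_neg_one, ← zpow_add₀ h0.ne', sub_eq_add_neg]
  -- the mover on the carrier, as a `ℚ`-linear map (as in p421508)
  let ψa : Carrier (.inr v : Place F) ≃+ Carrier (.inr v : Place F) :=
    (e.toAddEquiv.trans φ.toAddEquiv).trans e.symm.toAddEquiv
  let ψ : Carrier (.inr v : Place F) ≃ₗ[ℚ] Carrier (.inr v : Place F) :=
    { ψa with map_smul' := fun q x => map_rat_smul ψa q x }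
  have hψ : ∀ x, ψ x = e.symm (φ (e x)) := fun x => rfl
  have hψimg : ∀ S : Set K, ⇑ψ '' (e.symm '' S) = e.symm '' (⇑φ '' S) := by
    intro S
    ext y
    simp only [Set.mem_image, hψ]
    constructor
    · rintro ⟨x, ⟨z, hz, rfl⟩, rfl⟩
      exact ⟨φ z, ⟨z, hz, rfl⟩, by simp only [RingEquiv.apply_symm_apply]⟩
    · rintro ⟨w, ⟨z, hz, rfl⟩, rfl⟩
      exact ⟨e.symm z, ⟨z, hz, rfl⟩, by simp only [RingEquiv.apply_symm_apply]⟩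
  have hsmul : ∀ (m : ℕ) (S : Set K), e.symm (ϖ : K) ^ m • (e.symm '' S) = e.symm '' ((ϖ : K) ^ m • S) := by
    intro m S
    ext y
    simp only [Set.mem_smul_set, Set.mem_image, smul_eq_mul]
    constructor
    · rintro ⟨x, ⟨z, hz, rfl⟩, rfl⟩
      exact ⟨(ϖ : K) ^ m * z, ⟨z, hz, rfl⟩, by rw [map_mul, map_pow]⟩
    · rintro ⟨w, ⟨z, hz, rfl⟩, rfl⟩
      exact ⟨e.symm z, ⟨z, hz, rfl⟩, by rw [map_mul, map_pow]⟩
  have hc0 : e.symm (ϖ : K) ≠ 0 := (map_ne_zero_iff _ e.symm.injective).mpr ϖ.ne_zero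
  have hc1 : ‖e.symm (ϖ : K)‖ < 1 := by
    have h : ‖e.symm (ϖ : K)‖ = ‖(ϖ : K)‖ ^ localDeg F v :=
      RescaledCompletion.norm_eq_norm_of_pow F p v hv (e.symm (ϖ : K))
    exact h.trans_lt (pow_lt_one₀ (norm_nonneg _) h1 (localDeg_pos F v).ne')
  refine ⟨e.symm (ϖ : K), hc0, hc1, ψ, ⟨hφc, hφc', ?_⟩, fun n => ?_, fun n => ?_⟩
  · -- `φ` fixes the shell itself: the case `k = 0` of the parity law
    have h := hfix 0
    rw [show (2 : ℤ) * 0 - 1 = -1 by norm_num, zpow_neg_one] at h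
    rw [hshell, hψimg, h]
  · rw [hshell, hsmul, hψimg, hpow]
    have h := hfix n
    rw [show (2 : ℤ) * n - 1 = ((2 * n : ℕ) : ℤ) - 1 by push_cast; ring] at h
    rw [h]
  · rw [hshell, hsmul, hψimg, hpow]
    intro h
    have h' := e.symm.injective.image_injective h
    have hk := hmov n
    rw [show (2 : ℤ) * n = ((2 * n + 1 : ℕ) : ℤ) - 1 by push_cast; ring] at hk
    exact hk h'

end Instance

end Summit.ABC.IUTFork.Thm311.Real
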